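import Mathlib
import HarnessLib
import Summits.HubbardSuperconductivity.HubbardSuperconductivity.Theorems.KLProgrammeC4aFoldSignedLawSharp
import Summits.HubbardSuperconductivity.HubbardSuperconductivity.Theorems.KLProgrammeC4aFoldLevelLayerSharp

/-!
# Route `KLProgramme` — crux C4a, S3 brick (B4) «(U1)-LAWS» part 2: the LOG-FREE (POST-SIDE) FIRST-ORDER LAW OF A FOLD BOX — the sharp φ-layer composed with the
# sharp e-layer: `∫de w(e)·|∫dv X(e,v)·∂_uK(e, g(e,v))| ≤ P·(√|δ₀|)⁻¹`, NO `log(1/|δ₀|)`, NO `lo`, NO remainder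

Cell `gate-hubbard-kl`, seat hubbard-kl-k3c3-p3 (g31; row «implicit-function / monotonicity route for μ(n)»).  Located brick for the (C)-closer lane / the (M4)
assembly of the umklapp first-order ϑ-layer (stub (C) `stub_twoLeg_curvature` of `KLRegimeEngineV17F2`, stmt-HubbardSuperconductivity-20437), memo
HOME/hubbard-kl-k3c3-p3/U1-CAUSTIC-SUP.md §9–§11.  Companion of `…C4aFoldBoxTwoSidedLaw` (same fold-box family, same abstract kernel / weight / profile).

WHY.  The antipodal third of the cover theorem (`…C4aCausticWindowDispatchPartnerBand.intervalIntegral_caustic_dispatch_partnerBand_sInf_le`) needs, where `δ₀ < 0`,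
the LOG-FREE post-side law `F ≤ P·(√|δ₀|)⁻¹ + B + R` — a `log(1/|δ₀|)` on `|δ₀|^{−1/2}` is not integrable across the gap uniformly in its width (memo §3).  The sharp
φ-layer `…C4aFoldSignedLawSharp.abs_intervalIntegral_mul_deriv_comp_le_fold_sharp` carries on its `X₀·M^{−3/2}` terms only `log⁺(C₁M/e)` (`C₁ = 1 + 4L₂/c₂`), which the
sharp e-layer `…C4aFoldLevelLayerSharp.intervalIntegral_fold_first_order_layer_sharp_le` absorbs; its `X₁`-terms are `∝ M⁻¹` (`× (2 + 4log⁺(C₁M/e))`) and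
`∝ M⁻¹·log⁺((β−α)/x₁)`.  Here those are folded into the SAME `M⁻¹(√M)⁻¹(1 + log⁺(C₁M/e))` shape at the price of height constants (`M⁻¹ = √M·M⁻¹(√M)⁻¹ ≤ √M_up·…` with
`M ≤ M_up := G + hi`, and `log⁺ y ≤ y`), so the post-side law of a fold box is ONE CALL with NO remainder at all.
* §1 `posLog_le_self` (`log⁺ y ≤ y` for `y ≥ 0`) and **`fold_law_sharp_shape_le`** — the algebra: the sharp signed fold law's right-hand side at floor `t = e`, for
  `M ≤ M_up`, is `≤ (1 + log⁺(C₁M/e))·A_post·M⁻¹(√M)⁻¹` with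
  `A_post = X₀·(4/√L₂ + 16√L₂/c₂ + 64L₂²√L₂/c₂³ + 2√c₂/c₂ + L₂√c₂/c₂²) + X₁·(32L₂√M_up/c₂² + (β−α)√c₂/c₂)`.
* §2 **`intervalIntegral_foldBox_post_le`** — THE COMPOSITION (HEADLINE): setting of `…C4aFoldBoxTwoSidedLaw.intervalIntegral_foldBox_twoSided_le` ⟹
  `∫_{lo..hi} w(e)·|∫_{α..β} X(e,v)·(K e)′(g e v) dv| de ≤ W·A_post(G + hi)·K_c·(√|δ₀|)⁻¹`,
  `K_c = C√C(c₀ + 4) + 2c₀(C/λ₁)√(C/λ₁)`, `C = 4 + 2λ₂ + λ₁`, `c₀ = 1 + log 2 + log⁺(C₁(1+λ₂)) + log⁺ C₁` — exactly the `hpost` shape `P·(√|δ₀|)⁻¹ (+ B + R)` of the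
  window calls with `B = R = 0`; `n`-free (no `lo`), uniform in the box, valid for EITHER sign of `δ₀` (the dispatchers use it where `δ₀ < 0`).
Pure real analysis on landed lemmas; nothing about the model; nothing asserts (C), K3 or superconductivity.
References: Salmhofer 1999 §4.5.3 [cite: Salmhofer1999]; FST II CPAM 51 (1998) §3 [cite: FeldmanSalmhoferTrubowitz1998].
-/

noncomputable section

namespace Summit.HubbardSuperconductivity.HubbardSuperconductivity.Theorems.C4a

set_option linter.dupNamespace false -- summit = problem name (single-conjunct summit), D-0017

open Real Set MeasureTheory intervalIntegral

/-! ## §1 The shape of the sharp signed fold law at kernel floor `t = e` -/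

/-- `log⁺ y ≤ y` for `y ≥ 0`. -/
theorem posLog_le_self {y : ℝ} (hy : 0 ≤ y) : log⁺ y ≤ y := by
  rcases le_or_gt y 1 with h | h
  · rw [(Real.posLog_eq_zero_iff y).2 (by rw [abs_of_nonneg hy]; exact h)]; exact hy
  · rw [Real.posLog_eq_log (by rw [abs_of_nonneg hy]; exact h.le)]
    linarith [Real.log_le_sub_one_of_pos (zero_lt_one.trans h)]

/-- **The algebra of the sharp signed fold law.**  For `0 < M ≤ M_up`, `c₂, L₂ > 0`, `X₀, X₁, ℓ ≥ 0`, `α ≤ β`, the right-hand side of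
`…C4aFoldSignedLawSharp.abs_intervalIntegral_mul_deriv_comp_le_fold_sharp` (with `η = √M/(2√L₂)`, `σ = c₂η`, `x₁ = 2√(M/c₂)`, the level logarithm `ℓ` and the far-piece
logarithm `log⁺((β−α)/x₁)`) is at most `(1 + ℓ)·A_post·(M⁻¹(√M)⁻¹)`,
`A_post = X₀·(4/√L₂ + 16√L₂/c₂ + 64L₂²√L₂/c₂³ + 2√c₂/c₂ + L₂√c₂/c₂²) + X₁·(32L₂√M_up/c₂² + (β−α)√c₂/c₂)`. -/
theorem fold_law_sharp_shape_le {M Mup c₂ L₂ X₀ X₁ ℓ α β : ℝ} (hM : 0 < M) (hMup : M ≤ Mup) (hc₂ : 0 < c₂) (hL₂ : 0 < L₂) (hX₀ : 0 ≤ X₀) (hX₁ : 0 ≤ X₁)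
    (hℓ : 0 ≤ ℓ) (hαβ : α ≤ β) :
    8 * (Real.sqrt M / (2 * Real.sqrt L₂)) * X₀ / M ^ 2 +
        2 * (4 * X₀ / (M * (c₂ * (Real.sqrt M / (2 * Real.sqrt L₂)))) +
          (X₁ / (c₂ * (Real.sqrt M / (2 * Real.sqrt L₂))) + X₀ * L₂ / (c₂ * (Real.sqrt M / (2 * Real.sqrt L₂))) ^ 2) *
            ((c₂ * (Real.sqrt M / (2 * Real.sqrt L₂)))⁻¹ * (2 + 4 * ℓ))) +
        2 * (2 * X₀ / (M * (c₂ * (2 * Real.sqrt (M / c₂)))) + X₁ / (c₂ * M) * log⁺ ((β - α) / (2 * Real.sqrt (M / c₂))) +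
          X₀ * L₂ / (c₂ ^ 2 * M * (2 * Real.sqrt (M / c₂)))) ≤
      (1 + ℓ) * (X₀ * (4 / Real.sqrt L₂ + 16 * Real.sqrt L₂ / c₂ + 64 * L₂ ^ 2 * Real.sqrt L₂ / c₂ ^ 3 + 2 * Real.sqrt c₂ / c₂ + L₂ * Real.sqrt c₂ / c₂ ^ 2) +
          X₁ * (32 * L₂ * Real.sqrt Mup / c₂ ^ 2 + (β - α) * Real.sqrt c₂ / c₂)) * (M⁻¹ * (Real.sqrt M)⁻¹) := by
  obtain ⟨sM, hsM⟩ : ∃ sM : ℝ, sM = Real.sqrt M := ⟨_, rfl⟩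
  obtain ⟨sL, hsL⟩ : ∃ sL : ℝ, sL = Real.sqrt L₂ := ⟨_, rfl⟩
  obtain ⟨sc, hsc⟩ : ∃ sc : ℝ, sc = Real.sqrt c₂ := ⟨_, rfl⟩
  obtain ⟨su, hsu⟩ : ∃ su : ℝ, su = Real.sqrt Mup := ⟨_, rfl⟩
  have hsMpos : 0 < sM := by rw [hsM]; exact Real.sqrt_pos.2 hM
  have hsLpos : 0 < sL := by rw [hsL]; exact Real.sqrt_pos.2 hL₂
  have hscpos : 0 < sc := by rw [hsc]; exact Real.sqrt_pos.2 hc₂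
  have hsMu : sM ≤ su := by rw [hsM, hsu]; exact Real.sqrt_le_sqrt hMup
  have hM2 : M = sM ^ 2 := by rw [hsM, Real.sq_sqrt hM.le]
  have hL2 : L₂ = sL ^ 2 := by rw [hsL, Real.sq_sqrt hL₂.le]
  have hc2 : c₂ = sc ^ 2 := by rw [hsc, Real.sq_sqrt hc₂.le]
  have hx : Real.sqrt (M / c₂) = sM / sc := by rw [Real.sqrt_div hM.le, hsM, hsc]
  -- the far-piece logarithm: `log⁺((β−α)/x₁) ≤ (β−α)/x₁`
  have hℓ₂ : log⁺ ((β - α) / (2 * Real.sqrt (M / c₂))) ≤ (β - α) / (2 * (sM / sc)) := by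
    rw [hx]; exact posLog_le_self (by have := sub_nonneg.2 hαβ; positivity)
  have hℓ₂0 : 0 ≤ log⁺ ((β - α) / (2 * Real.sqrt (M / c₂))) := Real.posLog_nonneg
  obtain ⟨l₂, hl₂⟩ : ∃ l₂ : ℝ, l₂ = log⁺ ((β - α) / (2 * Real.sqrt (M / c₂))) := ⟨_, rfl⟩
  rw [← hl₂] at hℓ₂ hℓ₂0 ⊢
  rw [hx, ← hsM, ← hsL, ← hsc, ← hsu, hM2, hL2, hc2]
  -- group over the common factor `(M·√M)⁻¹ = (sM³)⁻¹`
  obtain ⟨P₀, hP₀⟩ : ∃ P₀ : ℝ, P₀ = X₀ * (4 / sL + 16 * sL / sc ^ 2 + 2 * sc / sc ^ 2 + sL ^ 2 * sc / (sc ^ 2) ^ 2) := ⟨_, rfl⟩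
  obtain ⟨P₄, hP₄⟩ : ∃ P₄ : ℝ, P₄ = 16 * X₀ * (sL ^ 2) ^ 2 * sL / (sc ^ 2) ^ 3 := ⟨_, rfl⟩
  obtain ⟨P₃, hP₃⟩ : ∃ P₃ : ℝ, P₃ = 8 * X₁ * sL ^ 2 / (sc ^ 2) ^ 2 := ⟨_, rfl⟩
  obtain ⟨P₆, hP₆⟩ : ∃ P₆ : ℝ, P₆ = 2 * X₁ / sc ^ 2 := ⟨_, rfl⟩
  have hP₀0 : 0 ≤ P₀ := by rw [hP₀]; positivity
  have hP₄0 : 0 ≤ P₄ := by rw [hP₄]; positivity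
  have hP₃0 : 0 ≤ P₃ := by rw [hP₃]; positivity
  have hP₆0 : 0 ≤ P₆ := by rw [hP₆]; positivity
  have hkey : 8 * (sM / (2 * sL)) * X₀ / (sM ^ 2) ^ 2 +
        2 * (4 * X₀ / (sM ^ 2 * (sc ^ 2 * (sM / (2 * sL)))) +
          (X₁ / (sc ^ 2 * (sM / (2 * sL))) + X₀ * sL ^ 2 / (sc ^ 2 * (sM / (2 * sL))) ^ 2) * ((sc ^ 2 * (sM / (2 * sL)))⁻¹ * (2 + 4 * ℓ))) +
        2 * (2 * X₀ / (sM ^ 2 * (sc ^ 2 * (2 * (sM / sc)))) + X₁ / (sc ^ 2 * sM ^ 2) * l₂ + X₀ * sL ^ 2 / ((sc ^ 2) ^ 2 * sM ^ 2 * (2 * (sM / sc)))) =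
      (P₀ + P₄ * (2 + 4 * ℓ) + P₃ * (2 + 4 * ℓ) * sM + P₆ * l₂ * sM) * (sM ^ 2 * sM)⁻¹ := by
    rw [hP₀, hP₄, hP₃, hP₆]
    field_simp
    ring
  have hkey2 : (1 + ℓ) * (X₀ * (4 / sL + 16 * sL / sc ^ 2 + 64 * (sL ^ 2) ^ 2 * sL / (sc ^ 2) ^ 3 + 2 * sc / sc ^ 2 + sL ^ 2 * sc / (sc ^ 2) ^ 2) +
          X₁ * (32 * sL ^ 2 * su / (sc ^ 2) ^ 2 + (β - α) * sc / sc ^ 2)) * ((sM ^ 2)⁻¹ * sM⁻¹) =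
      (1 + ℓ) * (P₀ + 4 * P₄ + 4 * P₃ * su + X₁ * (β - α) * sc / sc ^ 2) * (sM ^ 2 * sM)⁻¹ := by
    rw [hP₀, hP₄, hP₃]
    field_simp
    ring
  rw [hkey, hkey2]
  clear hkey hkey2
  have hfac : 0 ≤ (sM ^ 2 * sM)⁻¹ := by positivity
  refine mul_le_mul_of_nonneg_right ?_ hfac
  -- numerator comparison
  have h1 : P₀ + P₄ * (2 + 4 * ℓ) ≤ (1 + ℓ) * (P₀ + 4 * P₄) := by
    have ha := mul_nonneg hℓ hP₀0
    have hb := mul_nonneg hℓ hP₄0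
    linarith
  have h2 : P₃ * (2 + 4 * ℓ) * sM ≤ (1 + ℓ) * (4 * P₃ * su) := by
    have ha : (2 + 4 * ℓ) * sM ≤ (4 + 4 * ℓ) * su :=
      mul_le_mul (by linarith) hsMu hsMpos.le (by linarith)
    have hb := mul_le_mul_of_nonneg_left ha hP₃0
    linarith
  have h3 : P₆ * l₂ * sM ≤ (1 + ℓ) * (X₁ * (β - α) * sc / sc ^ 2) := by
    have ha : l₂ * sM ≤ (β - α) * sc / 2 := by
      have := mul_le_mul_of_nonneg_right hℓ₂ hsMpos.le
      refine this.trans (le_of_eq ?_)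
      field_simp
    have hb : P₆ * (l₂ * sM) ≤ P₆ * ((β - α) * sc / 2) := mul_le_mul_of_nonneg_left ha hP₆0
    have hc : P₆ * ((β - α) * sc / 2) = X₁ * (β - α) * sc / sc ^ 2 := by rw [hP₆]; field_simp
    have hd : 0 ≤ X₁ * (β - α) * sc / sc ^ 2 := by have := sub_nonneg.2 hαβ; positivity
    have he := mul_nonneg hℓ hd
    linarith
  linarith

/-! ## §2 The composition: sharp loop-angle layer ∘ sharp level layer -/

/-- **HEADLINE — THE LOG-FREE (POST-SIDE) FIRST-ORDER LAW OF A FOLD BOX.**  Levels `0 < lo ≤ hi`, loop window `[α, β]`; a fold-box family `g` with fold points `v*`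
(`(g e)′(v* e) = 0`, `v* e ∈ [α,β]`), floor `c₂ ≤ (g e)″`, ceiling `|(g e)″| ≤ L₂`, height `|g e| ≤ G` on the window, and the drift `δ₀ − λ₂e ≤ g e (v* e) ≤ δ₀ − λ₁e`
(`0 < λ₁ ≤ λ₂`, `δ₀ ≠ 0`); split kernel `K e` (`C¹`, `|K e u| ≤ 1/max(e,|u|)`, `|(K e)′ u| ≤ 1/max(e,|u|)²`); weight `X e` (`C¹`, `|X e| ≤ X₀`, `|(X e)′| ≤ X₁` on the
window, `X e α = X e β = 0`); profile `0 ≤ w ≤ W`.  THEN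
`∫_{lo..hi} w(e)·|∫_{α..β} X(e,v)·(K e)′(g e v) dv| de ≤ W·A_post·K_c·(√|δ₀|)⁻¹`,
`A_post = X₀·(4/√L₂ + 16√L₂/c₂ + 64L₂²√L₂/c₂³ + 2√c₂/c₂ + L₂√c₂/c₂²) + X₁·(32L₂√(G + hi)/c₂² + (β−α)√c₂/c₂)`,
`K_c = C√C·(c₀ + 4) + 2c₀·(C/λ₁)√(C/λ₁)`, `C = 4 + 2λ₂ + λ₁`, `c₀ = 1 + log 2 + log⁺((1 + 4L₂/c₂)(1 + λ₂)) + log⁺(1 + 4L₂/c₂)` — NO `log(1/|δ₀|)`, NO `lo`,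
NO remainder: the `hpost` hypothesis `F ≤ P·(√|δ₀|)⁻¹ + B + R` of the (U1) window calls with `B = R = 0`.  (No integrability hypothesis in `e`.) -/
theorem intervalIntegral_foldBox_post_le {g X K : ℝ → ℝ → ℝ} {vs w : ℝ → ℝ} {lo hi α β c₂ L₂ G X₀ X₁ W δ₀ la₁ la₂ : ℝ}
    (hlo : 0 < lo) (hlohi : lo ≤ hi) (hc₂ : 0 < c₂) (hG : 0 < G) (hX₀ : 0 ≤ X₀) (hX₁ : 0 ≤ X₁) (hW : 0 ≤ W)
    (hla₁ : 0 < la₁) (hla₁₂ : la₁ ≤ la₂) (hδ₀ : 0 < |δ₀|)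
    (hg : ∀ e ∈ Icc lo hi, ContDiff ℝ 2 (g e)) (hvs : ∀ e ∈ Icc lo hi, vs e ∈ Icc α β) (hcrit : ∀ e ∈ Icc lo hi, deriv (g e) (vs e) = 0)
    (hfloor : ∀ e ∈ Icc lo hi, ∀ v ∈ Icc α β, c₂ ≤ iteratedDeriv 2 (g e) v) (hL₂ : ∀ e ∈ Icc lo hi, ∀ v ∈ Icc α β, |iteratedDeriv 2 (g e) v| ≤ L₂)
    (hgG : ∀ e ∈ Icc lo hi, ∀ v ∈ Icc α β, |g e v| ≤ G)
    (hdrift : ∀ e ∈ Icc lo hi, δ₀ - la₂ * e ≤ g e (vs e) ∧ g e (vs e) ≤ δ₀ - la₁ * e)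
    (hK : ∀ e ∈ Icc lo hi, ContDiff ℝ 1 (K e)) (hK0 : ∀ e ∈ Icc lo hi, ∀ u, |K e u| ≤ (max e |u|)⁻¹)
    (hK1 : ∀ e ∈ Icc lo hi, ∀ u, |deriv (K e) u| ≤ (max e |u|)⁻¹ ^ 2)
    (hX : ∀ e ∈ Icc lo hi, ContDiff ℝ 1 (X e)) (hXb : ∀ e ∈ Icc lo hi, ∀ v ∈ Icc α β, |X e v| ≤ X₀)
    (hX₁b : ∀ e ∈ Icc lo hi, ∀ v ∈ Icc α β, |deriv (X e) v| ≤ X₁) (hXα : ∀ e ∈ Icc lo hi, X e α = 0) (hXβ : ∀ e ∈ Icc lo hi, X e β = 0)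
    (hw0 : ∀ e ∈ Icc lo hi, 0 ≤ w e) (hw : ∀ e ∈ Icc lo hi, w e ≤ W) :
    ∫ e in lo..hi, w e * |∫ v in α..β, X e v * deriv (K e) (g e v)| ≤
      W * (X₀ * (4 / Real.sqrt L₂ + 16 * Real.sqrt L₂ / c₂ + 64 * L₂ ^ 2 * Real.sqrt L₂ / c₂ ^ 3 + 2 * Real.sqrt c₂ / c₂ + L₂ * Real.sqrt c₂ / c₂ ^ 2) +
            X₁ * (32 * L₂ * Real.sqrt (G + hi) / c₂ ^ 2 + (β - α) * Real.sqrt c₂ / c₂)) *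
          ((4 + 2 * la₂ + la₁) * Real.sqrt (4 + 2 * la₂ + la₁) *
                ((1 + Real.log 2 + log⁺ ((1 + 4 * L₂ / c₂) * (1 + la₂)) + log⁺ (1 + 4 * L₂ / c₂)) + 4) +
            2 * (1 + Real.log 2 + log⁺ ((1 + 4 * L₂ / c₂) * (1 + la₂)) + log⁺ (1 + 4 * L₂ / c₂)) *
              ((4 + 2 * la₂ + la₁) / la₁ * Real.sqrt ((4 + 2 * la₂ + la₁) / la₁))) *
        (Real.sqrt |δ₀|)⁻¹ := by
  have hloI : lo ∈ Icc lo hi := left_mem_Icc.2 hlohi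
  have hαβ : α ≤ β := (hvs lo hloI).1.trans (hvs lo hloI).2
  have hL₂pos : 0 < L₂ := by
    have h1 := hfloor lo hloI (vs lo) (hvs lo hloI)
    have h2 := hL₂ lo hloI (vs lo) (hvs lo hloI)
    exact hc₂.trans_le (h1.trans ((le_abs_self _).trans h2))
  have hA : 0 ≤ X₀ * (4 / Real.sqrt L₂ + 16 * Real.sqrt L₂ / c₂ + 64 * L₂ ^ 2 * Real.sqrt L₂ / c₂ ^ 3 + 2 * Real.sqrt c₂ / c₂ + L₂ * Real.sqrt c₂ / c₂ ^ 2) +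
      X₁ * (32 * L₂ * Real.sqrt (G + hi) / c₂ ^ 2 + (β - α) * Real.sqrt c₂ / c₂) := by
    have := sub_nonneg.2 hαβ; positivity
  have hC₁ : 0 ≤ 1 + 4 * L₂ / c₂ := by positivity
  refine intervalIntegral_fold_first_order_layer_sharp_le (I := fun e => |∫ v in α..β, X e v * deriv (K e) (g e v)|) (m := fun e => g e (vs e))
    hlo hlohi hW hA hC₁ hla₁ hla₁₂ hδ₀ hdrift hw0 hw (fun e _ => abs_nonneg _) fun e he => ?_
  have he0 : 0 < e := hlo.trans_le he.1
  -- the sharp loop-angle layer at kernel floor `t = e`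
  have hφ := abs_intervalIntegral_mul_deriv_comp_le_fold_sharp (hvs e he) (hg e he) (hcrit e he) hc₂ (hfloor e he) (hL₂ e he)
    (hK e he) he0 (hK0 e he) (hK1 e he) (hX e he) (hXb e he) (hX₁b e he) (hXα e he) (hXβ e he)
  have hM : 0 < max e |g e (vs e)| := lt_max_of_lt_left he0
  have hMup : max e |g e (vs e)| ≤ G + hi :=
    max_le (he.2.trans (le_add_of_nonneg_left hG.le)) ((hgG e he (vs e) (hvs e he)).trans (le_add_of_nonneg_right (hlo.le.trans hlohi)))
  have hlog : log⁺ (max e |g e (vs e)| * (1 + 4 * L₂ / c₂) / e) = log⁺ ((1 + 4 * L₂ / c₂) * max e |g e (vs e)| / e) := by rw [mul_comm]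
  rw [hlog] at hφ
  refine hφ.trans ?_
  have h := fold_law_sharp_shape_le (ℓ := log⁺ ((1 + 4 * L₂ / c₂) * max e |g e (vs e)| / e)) hM hMup hc₂ hL₂pos hX₀ hX₁ Real.posLog_nonneg hαβ
  refine h.trans (le_of_eq ?_)
  ring

/-! ## §3 The `|m|`-form: either side of the Fermi level -/

/-- **THE LOG-FREE (POST-SIDE) LAW OF A FOLD BOX, `|m|`-FORM (either side of the Fermi level).**  As `intervalIntegral_foldBox_post_le`, but the drift
`δ₀ − λ₂e ≤ m e ≤ δ₀ − λ₁e` is asked of an auxiliary profile `m` with `|m e| = |g e (v* e)|` only (below the Fermi surface: the reflected family `s ↦ g (−s)` with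
`m s := −g (−s) (v*(−s))`, `δ₀ ↦ −δ₀`; `…C4aFoldBoxPartnerBand.partnerBand_foldValue_drift`, second clause). -/
theorem intervalIntegral_foldBox_post_le_of_abs {g X K : ℝ → ℝ → ℝ} {vs w m : ℝ → ℝ} {lo hi α β c₂ L₂ G X₀ X₁ W δ₀ la₁ la₂ : ℝ}
    (hlo : 0 < lo) (hlohi : lo ≤ hi) (hc₂ : 0 < c₂) (hG : 0 < G) (hX₀ : 0 ≤ X₀) (hX₁ : 0 ≤ X₁) (hW : 0 ≤ W)
    (hla₁ : 0 < la₁) (hla₁₂ : la₁ ≤ la₂) (hδ₀ : 0 < |δ₀|)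
    (hg : ∀ e ∈ Icc lo hi, ContDiff ℝ 2 (g e)) (hvs : ∀ e ∈ Icc lo hi, vs e ∈ Icc α β) (hcrit : ∀ e ∈ Icc lo hi, deriv (g e) (vs e) = 0)
    (hfloor : ∀ e ∈ Icc lo hi, ∀ v ∈ Icc α β, c₂ ≤ iteratedDeriv 2 (g e) v) (hL₂ : ∀ e ∈ Icc lo hi, ∀ v ∈ Icc α β, |iteratedDeriv 2 (g e) v| ≤ L₂)
    (hgG : ∀ e ∈ Icc lo hi, ∀ v ∈ Icc α β, |g e v| ≤ G)
    (hm : ∀ e ∈ Icc lo hi, |m e| = |g e (vs e)|) (hdrift : ∀ e ∈ Icc lo hi, δ₀ - la₂ * e ≤ m e ∧ m e ≤ δ₀ - la₁ * e)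
    (hK : ∀ e ∈ Icc lo hi, ContDiff ℝ 1 (K e)) (hK0 : ∀ e ∈ Icc lo hi, ∀ u, |K e u| ≤ (max e |u|)⁻¹)
    (hK1 : ∀ e ∈ Icc lo hi, ∀ u, |deriv (K e) u| ≤ (max e |u|)⁻¹ ^ 2)
    (hX : ∀ e ∈ Icc lo hi, ContDiff ℝ 1 (X e)) (hXb : ∀ e ∈ Icc lo hi, ∀ v ∈ Icc α β, |X e v| ≤ X₀)
    (hX₁b : ∀ e ∈ Icc lo hi, ∀ v ∈ Icc α β, |deriv (X e) v| ≤ X₁) (hXα : ∀ e ∈ Icc lo hi, X e α = 0) (hXβ : ∀ e ∈ Icc lo hi, X e β = 0)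
    (hw0 : ∀ e ∈ Icc lo hi, 0 ≤ w e) (hw : ∀ e ∈ Icc lo hi, w e ≤ W) :
    ∫ e in lo..hi, w e * |∫ v in α..β, X e v * deriv (K e) (g e v)| ≤
      W * (X₀ * (4 / Real.sqrt L₂ + 16 * Real.sqrt L₂ / c₂ + 64 * L₂ ^ 2 * Real.sqrt L₂ / c₂ ^ 3 + 2 * Real.sqrt c₂ / c₂ + L₂ * Real.sqrt c₂ / c₂ ^ 2) +
            X₁ * (32 * L₂ * Real.sqrt (G + hi) / c₂ ^ 2 + (β - α) * Real.sqrt c₂ / c₂)) *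
          ((4 + 2 * la₂ + la₁) * Real.sqrt (4 + 2 * la₂ + la₁) *
                ((1 + Real.log 2 + log⁺ ((1 + 4 * L₂ / c₂) * (1 + la₂)) + log⁺ (1 + 4 * L₂ / c₂)) + 4) +
            2 * (1 + Real.log 2 + log⁺ ((1 + 4 * L₂ / c₂) * (1 + la₂)) + log⁺ (1 + 4 * L₂ / c₂)) *
              ((4 + 2 * la₂ + la₁) / la₁ * Real.sqrt ((4 + 2 * la₂ + la₁) / la₁))) *
        (Real.sqrt |δ₀|)⁻¹ := by
  have hloI : lo ∈ Icc lo hi := left_mem_Icc.2 hlohi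
  have hαβ : α ≤ β := (hvs lo hloI).1.trans (hvs lo hloI).2
  have hL₂pos : 0 < L₂ := by
    have h1 := hfloor lo hloI (vs lo) (hvs lo hloI)
    have h2 := hL₂ lo hloI (vs lo) (hvs lo hloI)
    exact hc₂.trans_le (h1.trans ((le_abs_self _).trans h2))
  have hA : 0 ≤ X₀ * (4 / Real.sqrt L₂ + 16 * Real.sqrt L₂ / c₂ + 64 * L₂ ^ 2 * Real.sqrt L₂ / c₂ ^ 3 + 2 * Real.sqrt c₂ / c₂ + L₂ * Real.sqrt c₂ / c₂ ^ 2) +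
      X₁ * (32 * L₂ * Real.sqrt (G + hi) / c₂ ^ 2 + (β - α) * Real.sqrt c₂ / c₂) := by
    have := sub_nonneg.2 hαβ; positivity
  have hC₁ : 0 ≤ 1 + 4 * L₂ / c₂ := by positivity
  refine intervalIntegral_fold_first_order_layer_sharp_le (I := fun e => |∫ v in α..β, X e v * deriv (K e) (g e v)|) (m := m)
    hlo hlohi hW hA hC₁ hla₁ hla₁₂ hδ₀ hdrift hw0 hw (fun e _ => abs_nonneg _) fun e he => ?_
  have he0 : 0 < e := hlo.trans_le he.1
  have hφ := abs_intervalIntegral_mul_deriv_comp_le_fold_sharp (hvs e he) (hg e he) (hcrit e he) hc₂ (hfloor e he) (hL₂ e he)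
    (hK e he) he0 (hK0 e he) (hK1 e he) (hX e he) (hXb e he) (hX₁b e he) (hXα e he) (hXβ e he)
  have hM : 0 < max e |g e (vs e)| := lt_max_of_lt_left he0
  have hMup : max e |g e (vs e)| ≤ G + hi :=
    max_le (he.2.trans (le_add_of_nonneg_left hG.le)) ((hgG e he (vs e) (hvs e he)).trans (le_add_of_nonneg_right (hlo.le.trans hlohi)))
  have hlog : log⁺ (max e |g e (vs e)| * (1 + 4 * L₂ / c₂) / e) = log⁺ ((1 + 4 * L₂ / c₂) * max e |g e (vs e)| / e) := by rw [mul_comm]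
  rw [hlog] at hφ
  rw [hm e he]
  refine hφ.trans ?_
  have h := fold_law_sharp_shape_le (ℓ := log⁺ ((1 + 4 * L₂ / c₂) * max e |g e (vs e)| / e)) hM hMup hc₂ hL₂pos hX₀ hX₁ Real.posLog_nonneg hαβ
  refine h.trans (le_of_eq ?_)
  ring

end Summit.HubbardSuperconductivity.HubbardSuperconductivity.Theorems.C4a

end
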